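import Summits.QuantumFields.YangMills.Theorems.BalabanUVNodesN22AtGeneratedHistory12

/-!
# N22 AT THE ADMISSIBLE READING OF RECORD ON THE GENERATED RUN TOWERS — THE SHARP SOCKET: the per-step schemas and the admissibility bookkeeping asked ONLY
# FOR THE STEPS THE RUN OF RECORD PERFORMS (`m < k` on the `k`-th torus), the holomorphy clause factored out as a hypothesis of its own

Track A of `YM-PLAN.md` (cell `pub-ymgap`, HUMAN RULING D-0062), R134 seat `pub-ymgap-dag-n22-e` ((T-RATE) pen ∕ N22 NE9 s2), gen 4, module 8c.  THEOREMS ONLY (no `def`, no `sorry`);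
`--supports` K3″ `SpineGivenEndpointR12` (stmt-QuantumFields-19908) as a helper; restate-immune (no Theses import).  Imports module 8b (`…N22AtGeneratedHistory12`, p486766).

WHY.  Module 8b's `supLetterA_truncRun_toClusterTower_of_schemas` ∕ `n22At_u3OfRecord₁₂_ofRecordAdm_gen_of_n18Below_schemas` ask W1's per-step schemas (A-last)ₘ, (A-prop)ₘ and the
admissibility bookkeeping `RecAdmissible` at EVERY step `m` of the generator on the `k`-th torus — also at the steps `m ≥ k` which the run of record never performs (node00-def-W1
g4's `runTowers` truncates them: [Balaban1987RG1] (0.23)–(0.24), the run of `k` steps creates the terms of creation steps `1, …, k` only).  That is analyticity data about junk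
(dag-n22-c g4's point for the `EHoloAt` socket, answered by W1 g4's `exists_eHoloAt_truncRun_of_lt`).  The strong induction behind `analyticInEach_recTerm` reads, for a level
`j`, only the schemas of the steps `< j`; so for the levels `j ≤ K` the schemas BELOW `K` suffice.  This module (i) factors module 8b §1 through the HOLOMORPHY CLAUSE as a
hypothesis of its own (`…_of_holo`: «for `g` in the window, `i < j ≤ K`, `φ` in all spaces, `z ↦ recTerm G (↑g[i ↦ z]) j X φ` is complex-differentiable on `Dk`» — so that any
producer of that clause, W1's induction or another, feeds the same socket), (ii) feeds it by node00-def-W1 g5's SHARP INDUCTION `Node00.W1.analyticInEach_recTerm_of_lt`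
(`HistoryRecursionOfRecord` v1.2, taken on this seat's ask: W1's strong induction with the bound `j ≤ K` threaded — the schemas and the admissibility of the generated older
terms asked for the steps `< K` only), and (iii) re-issues 8b's θ-form and stub-level faces with the schema package quantified over the steps `m < k` only (`…_of_schemasBelow`).  Everything else — (J) discharged, coherence ∕ readings clause by type, the complex sup letter displayed — is as in 8b.

WHAT THIS MODULE PROVES ([folklore] bookkeeping; every estimate stays a displayed hypothesis).
* §1 `supLetterA_truncRun_toClusterTower_of_holo` — module 4's `hA` literal for `functionalC (truncRun K (toClusterTower G))` from: `Dk` open, conj-symmetric, ⊇ the closed `r`-discs,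
  the HOLOMORPHY CLAUSE for the levels `j ≤ K`, `A, μ ≥ 0`, the complex sup letter for the levels `j ≤ K` (Schwarz symmetrisation as in 8b).
* §2 `supLetterA_truncRun_toClusterTower_of_schemasBelow` — §1 fed by W1's `analyticInEach_recTerm_of_lt` (`RecAdmissible` ∕ (A-last)ₘ ∕ (A-prop)ₘ for `m < K` only).
* §3 θ-form `n22At_u3OfRecord₁₂_ofRecordAdm_gen_of_n18Below_schemasBelow` and stub level `s_N22_rRec₁₂_w1_gen_of_s_N18_schemasBelow` ∕ `s_N22_rRec₁₂On_w1_gen_of_s_N18_schemasBelow` ∕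
  `s_N22_readingOfRecord₁₂_gen_of_s_N18_schemasBelow` ∕ `s_N22_readingOfRecord₁₂On_gen_of_s_N18_schemasBelow` — 8b §2–§3 with the SHARP package
  `∃ Dk Adm, open ∧ conj-symm ∧ ⊇ closed li.r-discs ∧ (admissibility below k) ∧ (∀ m < k, (A-last)ₘ) ∧ (∀ m < k, (A-prop)ₘ) ∧ complex sup letter (j ≤ k)`.
  (Non-vacuity: 8b's `genSchemas_nonvacuous` witness satisfies the sharp package a fortiori.)
* §4 at node00-def-W1's GENERATED tables (`RateRecordW1MapsAdm` v1.1, p485559: `spGen`, `hT₀_spGen`, `ReadingData.ofRecordGen` — the transport clause a THEOREM):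
  `n22At_u3OfRecord₁₂_ofRecordGen_gen_of_n18Below_schemasBelow` (θ-form) · `s_N22_readingOfRecord₁₂_ofRecordGen_gen_of_s_N18_schemasBelow` (ed. 1, canonical home) — every
  W1 slot object named but the generator `G`, the strict class `Pplus`, `T₀`, the gauge and the letters; NO transport clause displayed.

HONEST FRAMING.  COUNT-NEUTRAL kernel bookkeeping BY NAME; NE5 ∕ NE9 NOT PRINTED for d = 4 and NOT PROVED; the generators, the table family, the gauge, `T₀` and its preservation
clause are PARAMETERS; node N18's stub, the per-step schemas (asserted nowhere), the complex sup letter (NOT PRINTED) and the numerals are DISPLAYED hypotheses; nothing of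
Bałaban's is asserted; no inhabitant of any Stage-12 key claimed (K0″ open); N22 NOT discharged; counts UNMOVED (typed 28∕28 · discharged 5∕27, A 5∕28); one finite four-torus
programme at fixed `ε` — NOT ℝ⁴, NOT infinite volume, NOT OS, NOT a mass gap, NOT Clay.  No decl carries a cite tag.
-/

noncomputable section

namespace YMDAG.N22

open Set Metric ComplexConjugate
open scoped BigOperators
open Literature.MathematicalPhysics.QuantumFieldTheory.Balaban1983to89
open Literature.MathematicalPhysics.QuantumFieldTheory.Balaban1983to89.T4Continuum
open Literature.MathematicalPhysics.QuantumFieldTheory.Balaban1983to89.T4OutputRate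
open Literature.MathematicalPhysics.QuantumFieldTheory.Balaban1983to89.Node00
  (Stage12Params NE2Objects₁₁ NE3Letters₁₁ MatA ιSU)
open Literature.MathematicalPhysics.QuantumFieldTheory.Balaban1983to89.Node00.Sect2 (domSys CPair ofBackgroundC)
open Literature.MathematicalPhysics.QuantumFieldTheory.Balaban1983to89.Node00.W1
open YMDAG.UVSplit

variable {N : ℕ} [NeZero N]

/-! ## §1 The analytic letter (A) on a generated run tower from the holomorphy clause and the complex sup letter -/

section Holo

variable {P : Params} {𝔸 : Type*} {M : ℕ}

omit [NeZero N] in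
/-- **THE ANALYTIC LETTER (A) ON A GENERATED RUN TOWER FROM THE HOLOMORPHY CLAUSE** (module 8b §1 factored): for a generator `G`, a run length `K`, a table `sp`, a window radius
`γ`, an OPEN CONJUGATION-SYMMETRIC `Dk ⊇` the closed `r`-discs about `]0, γ]`, the HOLOMORPHY CLAUSE «for `g` in the window, `i < j ≤ K`, `X ∈ 𝐃_j`, `φ ∈ sp j X`:
`z ↦ recTerm G (↑g[i ↦ z]) j X φ` is complex-differentiable on `Dk`», letters `A, μ ≥ 0` and the complex sup letter for the levels `j ≤ K` ⟹ module 4's `hA` literal for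
`functionalC (truncRun K (toClusterTower G))` at every configuration in all spaces (witness: Schwarz symmetrisation within the run, `0` beyond). [folklore] -/
theorem supLetterA_truncRun_toClusterTower_of_holo (G : GenTower P 𝔸 M) (K : ℕ)
    (sp : (j : ℕ) → (domSys P M j).Dom → Set (CPair P 𝔸)) {γ A μ κ r : ℝ} {Dk : Set ℂ}
    (hDo : IsOpen Dk) (hDc : ∀ z ∈ Dk, conj z ∈ Dk) (hDr : ∀ t ∈ Ioc (0 : ℝ) γ, closedBall (t : ℂ) r ⊆ Dk)
    (hholo : ∀ g ∈ Window γ, ∀ (i j : ℕ), i < j → j ≤ K → ∀ (X : (domSys P M j).Dom), ∀ φ ∈ sp j X,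
      DifferentiableOn ℂ (fun z => recTerm G (Function.update (fun n => ((g n : ℝ) : ℂ)) i z) j X φ) Dk)
    (hA0 : 0 ≤ A) (hμ : 0 ≤ μ)
    (hB : ∀ g ∈ Window γ, ∀ (i j : ℕ), i < j → j ≤ K → ∀ (X : (domSys P M j).Dom), ∀ φ ∈ sp j X, ∀ z ∈ Dk,
      ‖recTerm G (Function.update (fun n => ((g n : ℝ) : ℂ)) i z) j X φ‖ ≤ A * μ ^ (j - 1 - i) * Real.exp (-(κ * (domSys P M j).dj X)))
    (φ : CPair P 𝔸) (hφ : ∀ (j : ℕ) (Y : (domSys P M j).Dom), φ ∈ sp j Y) :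
    ∀ g ∈ Window γ, ∀ (X : Node00.W1.Dom P M) (i : ℕ), i < X.1 →
      ∃ (Fz : ℂ → ℂ) (Dset : Set ℂ), DifferentiableOn ℂ Fz Dset ∧
        (∀ z ∈ Dset, ‖Fz z‖ ≤ A * μ ^ (X.1 - 1 - i) * Real.exp (-(κ * (domSys P M X.1).dj X.2))) ∧
        (∀ t ∈ Ioc (0 : ℝ) γ, closedBall (t : ℂ) r ⊆ Dset) ∧
        (∀ t ∈ Ioc (0 : ℝ) γ, Fz t = ((functionalC (truncRun K (toClusterTower G)) (Function.update g i t) φ X).re : ℂ)) := by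
  intro g hg X i hi
  have hbd : 0 ≤ A * μ ^ (X.1 - 1 - i) * Real.exp (-(κ * (domSys P M X.1).dj X.2)) :=
    mul_nonneg (mul_nonneg hA0 (pow_nonneg hμ _)) (Real.exp_nonneg _)
  rcases Nat.lt_or_ge K X.1 with hXK | hXK
  · -- beyond the run length: the term, hence the functional, is zero
    refine ⟨fun _ => 0, Dk, differentiableOn_const _, fun z _ => ?_, hDr, fun t _ => ?_⟩
    · show ‖(0 : ℂ)‖ ≤ _
      rw [norm_zero]
      exact hbd
    · show (0 : ℂ) = _
      rw [functionalC_truncRun_eq_zero _ _ φ X hXK, Complex.zero_re, Complex.ofReal_zero]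
  · -- within the run: the generated term at the complexified coupling, Schwarz-symmetrised
    have hf : DifferentiableOn ℂ (fun z => recTerm G (Function.update (fun n => ((g n : ℝ) : ℂ)) i z) X.1 X.2 φ) Dk :=
      hholo g hg i X.1 hi hXK X.2 φ (hφ X.1 X.2)
    have hfc : DifferentiableOn ℂ (fun z => conj (recTerm G (Function.update (fun n => ((g n : ℝ) : ℂ)) i (conj z)) X.1 X.2 φ)) Dk := by
      intro z hz
      have hd : DifferentiableAt ℂ (fun z => recTerm G (Function.update (fun n => ((g n : ℝ) : ℂ)) i z) X.1 X.2 φ) (conj z) :=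
        hf.differentiableAt (hDo.mem_nhds (hDc z hz))
      have := hd.conj_conj
      rw [Complex.conj_conj] at this
      exact this.differentiableWithinAt
    refine ⟨fun z => (recTerm G (Function.update (fun n => ((g n : ℝ) : ℂ)) i z) X.1 X.2 φ +
        conj (recTerm G (Function.update (fun n => ((g n : ℝ) : ℂ)) i (conj z)) X.1 X.2 φ)) / 2,
      Dk, (hf.add hfc).div_const 2, fun z hz => ?_, hDr, fun t ht => ?_⟩
    · have h1 := hB g hg i X.1 hi hXK X.2 φ (hφ X.1 X.2) z hz
      have h2 := hB g hg i X.1 hi hXK X.2 φ (hφ X.1 X.2) (conj z) (hDc z hz)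
      have h3 : ‖(recTerm G (Function.update (fun n => ((g n : ℝ) : ℂ)) i z) X.1 X.2 φ +
          conj (recTerm G (Function.update (fun n => ((g n : ℝ) : ℂ)) i (conj z)) X.1 X.2 φ)) / 2‖ ≤
          (‖recTerm G (Function.update (fun n => ((g n : ℝ) : ℂ)) i z) X.1 X.2 φ‖ +
            ‖recTerm G (Function.update (fun n => ((g n : ℝ) : ℂ)) i (conj z)) X.1 X.2 φ‖) / 2 := by
        rw [norm_div, Complex.norm_two]
        gcongr
        exact (norm_add_le _ _).trans (by rw [Complex.norm_conj])
      linarith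
    · show (recTerm G (Function.update (fun n => ((g n : ℝ) : ℂ)) i (t : ℂ)) X.1 X.2 φ +
          conj (recTerm G (Function.update (fun n => ((g n : ℝ) : ℂ)) i (conj (t : ℂ))) X.1 X.2 φ)) / 2 = _
      have hup : (fun n => ((Function.update g i t n : ℝ) : ℂ)) = Function.update (fun n => ((g n : ℝ) : ℂ)) i (t : ℂ) :=
        Function.comp_update (fun x : ℝ => (x : ℂ)) g i t
      rw [Complex.conj_ofReal, functionalC_truncRun_of_le _ _ φ X hXK, functionalC_toClusterTower, hup, Complex.add_conj]
      push_cast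
      ring

end Holo

/-! ## §2 The analytic letter (A) from the schemas below the run length (W1's sharp induction) -/

section SharpInduction

variable {P : Params} {𝔸 : Type*} {M : ℕ}

/-- **THE ANALYTIC LETTER (A) ON A GENERATED RUN TOWER FROM THE SCHEMAS BELOW THE RUN LENGTH**: module 8b's `supLetterA_truncRun_toClusterTower_of_schemas` with
`RecAdmissible` ∕ (A-last)ₘ ∕ (A-prop)ₘ asked only for the steps `m < K` — §1 fed by node00-def-W1's sharp induction `analyticInEach_recTerm_of_lt`. [folklore] -/
theorem supLetterA_truncRun_toClusterTower_of_schemasBelow (G : GenTower P 𝔸 M) (K : ℕ)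
    (sp : (j : ℕ) → (domSys P M j).Dom → Set (CPair P 𝔸)) {γ A μ κ r : ℝ} {Dk : Set ℂ}
    (hDo : IsOpen Dk) (hDc : ∀ z ∈ Dk, conj z ∈ Dk) (hDr : ∀ t ∈ Ioc (0 : ℝ) γ, closedBall (t : ℂ) r ⊆ Dk) (hr : 0 ≤ r)
    {Adm : (m : ℕ) → Set (OlderTerms P 𝔸 M m)} (hAdm : ∀ g : ℕ → ℂ, (∀ n, g n ∈ Dk) → ∀ m < K, olderOf (recTerm G g) m ∈ Adm m)
    (hlast : ∀ m < K, (G m).AnalyticInLast Dk (Adm m) (sp (m + 1)))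
    (hprop : ∀ m < K, (G m).PropagatesAnalyticity Dk (Adm m) (fun j : Fin (m + 1) => sp j) (sp (m + 1)))
    (hA0 : 0 ≤ A) (hμ : 0 ≤ μ)
    (hB : ∀ g ∈ Window γ, ∀ (i j : ℕ), i < j → j ≤ K → ∀ (X : (domSys P M j).Dom), ∀ φ ∈ sp j X, ∀ z ∈ Dk,
      ‖recTerm G (Function.update (fun n => ((g n : ℝ) : ℂ)) i z) j X φ‖ ≤ A * μ ^ (j - 1 - i) * Real.exp (-(κ * (domSys P M j).dj X)))
    (φ : CPair P 𝔸) (hφ : ∀ (j : ℕ) (Y : (domSys P M j).Dom), φ ∈ sp j Y) :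
    ∀ g ∈ Window γ, ∀ (X : Node00.W1.Dom P M) (i : ℕ), i < X.1 →
      ∃ (Fz : ℂ → ℂ) (Dset : Set ℂ), DifferentiableOn ℂ Fz Dset ∧
        (∀ z ∈ Dset, ‖Fz z‖ ≤ A * μ ^ (X.1 - 1 - i) * Real.exp (-(κ * (domSys P M X.1).dj X.2))) ∧
        (∀ t ∈ Ioc (0 : ℝ) γ, closedBall (t : ℂ) r ⊆ Dset) ∧
        (∀ t ∈ Ioc (0 : ℝ) γ, Fz t = ((functionalC (truncRun K (toClusterTower G)) (Function.update g i t) φ X).re : ℂ)) := by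
  refine supLetterA_truncRun_toClusterTower_of_holo G K sp hDo hDc hDr (fun g hg i j hij hjK X φ' hφ' => ?_) hA0 hμ hB φ hφ
  have hg' : ∀ n, 0 < g n ∧ g n ≤ γ := hg
  have hgc : ∀ n, (fun n => ((g n : ℝ) : ℂ)) n ∈ Dk := fun n => hDr (g n) ⟨(hg' n).1, (hg' n).2⟩ (mem_closedBall_self hr)
  exact (analyticInEach_recTerm_of_lt G K hAdm hlast hprop j hjK _ hgc i hij X φ' hφ').differentiableOn

end SharpInduction

/-! ## §3 θ-form and stub level with the sharp schema package -/

section Theta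

variable {F : T4Family} (θ : Stage12Params F N) (G : (k : ℕ) → GenTower (F.P k) (MatA N) θ.τ9.M)
  (sp : (k j : ℕ) → (domSys (F.P k) θ.τ9.M j).Dom → Set (CPair (F.P k) (MatA N)))
  (gauge : (k : ℕ) → GaugeField (F.P k) 0 (Node00.SU N) → GaugeField (F.P k) 0 (Node00.SU N) → ℝ) (hg : ∀ k U U', 0 ≤ gauge k U U')
  (T₀ : (k : ℕ) → GaugeField (F.P (k + 1)) 0 (Node00.SU N) → GaugeField (F.P k) 0 (Node00.SU N))
  (hT₀ : ∀ (k : ℕ) (U : GaugeField (F.P (k + 1)) 0 (Node00.SU N)),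
    (∀ (j : ℕ) (Y : (domSys (F.P (k + 1)) θ.τ9.M j).Dom), ofBackgroundC (ιSU N) U ∈ sp (k + 1) j Y) →
    ∀ (j : ℕ) (Y : (domSys (F.P k) θ.τ9.M j).Dom), ofBackgroundC (ιSU N) (T₀ k U) ∈ sp k j Y)
  (li : LetterInputs) (k : ℕ)

/-- **N18 BELOW `k` ⇒ N22 AT `k` AT THE ADMISSIBLE READING ON THE GENERATED RUN TOWERS — SHARP SCHEMA PACKAGE** (admissibility, (A-last)ₘ, (A-prop)ₘ for the steps `m < k`
only; the complex sup letter for the levels `j ≤ k`).  Module 8b §2 with §2. [folklore] -/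
theorem n22At_u3OfRecord₁₂_ofRecordAdm_gen_of_n18Below_schemasBelow
    (h18 : ∀ k' : ℕ, k' < k → N18At (u3OfRecord₁₂ θ
      ((ReadingData.ofRecordAdm F θ.τ9.M N (runTowers fun k => toClusterTower (G k)) sp gauge hg T₀ hT₀ li).u3Objects θ.γ) k'))
    (hsch : ∃ (Dk : Set ℂ) (Adm : (m : ℕ) → Set (OlderTerms (F.P k) (MatA N) θ.τ9.M m)),
      IsOpen Dk ∧ (∀ z ∈ Dk, conj z ∈ Dk) ∧ (∀ t ∈ Ioc (0 : ℝ) θ.γ, closedBall (t : ℂ) li.r ⊆ Dk) ∧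
      (∀ g : ℕ → ℂ, (∀ n, g n ∈ Dk) → ∀ m < k, olderOf (recTerm (G k) g) m ∈ Adm m) ∧
      (∀ m < k, (G k m).AnalyticInLast Dk (Adm m) (sp k (m + 1))) ∧
      (∀ m < k, (G k m).PropagatesAnalyticity Dk (Adm m) (fun j : Fin (m + 1) => sp k j) (sp k (m + 1))) ∧
      (∀ g ∈ Window θ.γ, ∀ (i j : ℕ), i < j → j ≤ k → ∀ (X : (domSys (F.P k) θ.τ9.M j).Dom), ∀ φ ∈ sp k j X, ∀ z ∈ Dk,
        ‖recTerm (G k) (Function.update (fun n => ((g n : ℝ) : ℂ)) i z) j X φ‖ ≤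
          li.A * li.μ ^ (j - 1 - i) * Real.exp (-(li.κ * (domSys (F.P k) θ.τ9.M j).dj X))))
    (hnum : 0 < li.C₀ ∧ 0 < li.θ₅ ∧ li.θ₅ < 1 ∧ 0 ≤ li.C₅ ∧ 2 * li.C₅ / (1 - li.θ₅) ≤ li.C₀ ∧ 0 < li.A ∧ li.θ₅ ≤ li.μ ∧
      li.C₀ ≤ 2 * li.A ∧ 0 < li.r ∧ 0 < li.s ∧ li.s < 1)
    (hγ : 0 < θ.γ) :
    N22At (u3OfRecord₁₂ θ
      ((ReadingData.ofRecordAdm F θ.τ9.M N (runTowers fun k => toClusterTower (G k)) sp gauge hg T₀ hT₀ li).u3Objects θ.γ) k) := by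
  obtain ⟨Dk, Adm, hDo, hDc, hDr, hAdm, hlast, hprop, hB⟩ := hsch
  have hθ5 : 0 < li.θ₅ := hnum.2.1
  have hA : 0 < li.A := hnum.2.2.2.2.2.1
  have hθμ : li.θ₅ ≤ li.μ := hnum.2.2.2.2.2.2.1
  have hr : 0 < li.r := hnum.2.2.2.2.2.2.2.2.1
  refine n22At_u3OfRecord₁₂_ofRecordAdm_of_n18Below_analytic θ (runTowers fun k => toClusterTower (G k)) sp gauge hg T₀ hT₀ li k h18
    (fun k X hk g φ => (termlessBeyond_runTowers (fun k => toClusterTower (G k)) k).functionalC_eq_zero g φ X hk)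
    (fun g hg' U X i hi => ?_) hnum hγ
  exact supLetterA_truncRun_toClusterTower_of_schemasBelow (G k) k (sp k) hDo hDc hDr hr.le hAdm hlast hprop hA.le (hθ5.le.trans hθμ) hB
    (ofBackgroundC (ιSU N) U.1) U.2 g hg' X i hi

end Theta

section Stub

variable (G : (F : T4Family) → (θ : Stage12Params F N) → (k : ℕ) → GenTower (F.P k) (MatA N) θ.τ9.M)
  (sp : (F : T4Family) → (θ : Stage12Params F N) → (k j : ℕ) → (domSys (F.P k) θ.τ9.M j).Dom → Set (CPair (F.P k) (MatA N)))
  (gauge : (F : T4Family) → (θ : Stage12Params F N) → (k : ℕ) → GaugeField (F.P k) 0 (Node00.SU N) → GaugeField (F.P k) 0 (Node00.SU N) → ℝ)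
  (hg : ∀ (F : T4Family) (θ : Stage12Params F N) (k : ℕ) (U U' : GaugeField (F.P k) 0 (Node00.SU N)), 0 ≤ gauge F θ k U U')
  (T₀ : (F : T4Family) → (θ : Stage12Params F N) → (k : ℕ) → GaugeField (F.P (k + 1)) 0 (Node00.SU N) → GaugeField (F.P k) 0 (Node00.SU N))
  (hT₀ : ∀ (F : T4Family) (θ : Stage12Params F N) (k : ℕ) (U : GaugeField (F.P (k + 1)) 0 (Node00.SU N)),
    (∀ (j : ℕ) (Y : (domSys (F.P (k + 1)) θ.τ9.M j).Dom), ofBackgroundC (ιSU N) U ∈ sp F θ (k + 1) j Y) →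
    ∀ (j : ℕ) (Y : (domSys (F.P k) θ.τ9.M j).Dom), ofBackgroundC (ιSU N) (T₀ F θ k U) ∈ sp F θ k j Y)
  (li : (F : T4Family) → Stage12Params F N → LetterInputs)
  (ne1 : (F : T4Family) → Stage12Params F N → (ℕ → ℝ) → List (ULoop F) → NE1pCarriers)

/-- **`S_N22` AT THE CANONICAL HOME FROM `S_N18` AND THE SHARP SCHEMA PACKAGE** (any residual inputs `𝔇` whose W1 component IS the admissible reading on the generated run
towers, `h𝔇`): module 8b's `s_N22_rRec₁₂_w1_gen_of_s_N18_schemas` with admissibility ∕ (A-last)ₘ ∕ (A-prop)ₘ asked for the steps `m < k` only. [folklore] -/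
theorem s_N22_rRec₁₂_w1_gen_of_s_N18_schemasBelow (𝔇 : AssignmentInputs₁₂ N)
    (h𝔇 : ∀ (F : T4Family) (θ : Stage12Params F N), 𝔇.w1 F θ =
      ReadingData.ofRecordAdm F θ.τ9.M N (runTowers fun k => toClusterTower (G F θ k)) (sp F θ) (gauge F θ) (hg F θ) (T₀ F θ) (hT₀ F θ) (li F θ))
    (h18 : S_N18 (RRec₁₂ (RateReading₁₂.ofAssignment (assignment₁₂ 𝔇) ne1)))
    (hsch : ∀ (F : T4Family) (θ : Stage12Params F N), θ.Provisos₁₂ F N → θ.Admissible F N → ∀ (k : ℕ),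
      ∃ (Dk : Set ℂ) (Adm : (m : ℕ) → Set (OlderTerms (F.P k) (MatA N) θ.τ9.M m)),
        IsOpen Dk ∧ (∀ z ∈ Dk, conj z ∈ Dk) ∧ (∀ t ∈ Ioc (0 : ℝ) θ.γ, closedBall (t : ℂ) (li F θ).r ⊆ Dk) ∧
        (∀ g : ℕ → ℂ, (∀ n, g n ∈ Dk) → ∀ m < k, olderOf (recTerm (G F θ k) g) m ∈ Adm m) ∧
        (∀ m < k, (G F θ k m).AnalyticInLast Dk (Adm m) (sp F θ k (m + 1))) ∧
        (∀ m < k, (G F θ k m).PropagatesAnalyticity Dk (Adm m) (fun j : Fin (m + 1) => sp F θ k j) (sp F θ k (m + 1))) ∧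
        (∀ g ∈ Window θ.γ, ∀ (i j : ℕ), i < j → j ≤ k → ∀ (X : (domSys (F.P k) θ.τ9.M j).Dom), ∀ φ ∈ sp F θ k j X, ∀ z ∈ Dk,
          ‖recTerm (G F θ k) (Function.update (fun n => ((g n : ℝ) : ℂ)) i z) j X φ‖ ≤
            (li F θ).A * (li F θ).μ ^ (j - 1 - i) * Real.exp (-((li F θ).κ * (domSys (F.P k) θ.τ9.M j).dj X))))
    (hnum : ∀ (F : T4Family) (θ : Stage12Params F N), θ.Provisos₁₂ F N → θ.Admissible F N →
      0 < (li F θ).C₀ ∧ 0 < (li F θ).θ₅ ∧ (li F θ).θ₅ < 1 ∧ 0 ≤ (li F θ).C₅ ∧ 2 * (li F θ).C₅ / (1 - (li F θ).θ₅) ≤ (li F θ).C₀ ∧ 0 < (li F θ).A ∧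
        (li F θ).θ₅ ≤ (li F θ).μ ∧ (li F θ).C₀ ≤ 2 * (li F θ).A ∧ 0 < (li F θ).r ∧ 0 < (li F θ).s ∧ (li F θ).s < 1) :
    S_N22 (RRec₁₂ (RateReading₁₂.ofAssignment (assignment₁₂ 𝔇) ne1)) := by
  rw [s_N22_rRec₁₂_w1_iff]
  rw [s_N18_rRec₁₂_iff] at h18
  intro F D h k
  show N22At (u3OfRecord₁₂ h.params ((𝔇.w1 F h.params).u3Objects h.params.γ) k)
  rw [h𝔇 F h.params]
  refine n22At_u3OfRecord₁₂_ofRecordAdm_gen_of_n18Below_schemasBelow h.params (G F h.params) (sp F h.params) (gauge F h.params) (hg F h.params)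
    (T₀ F h.params) (hT₀ F h.params) (li F h.params) k (fun k' _ => ?_) (hsch F h.params h.provisos h.admissible k)
    (hnum F h.params h.provisos h.admissible) h.gamma_pos
  have h18' : N18At (u3OfRecord₁₂ h.params ((𝔇.w1 F h.params).u3Objects h.params.γ) k') := h18 F D h (fun _ => 0) [] k'
  rw [h𝔇 F h.params] at h18'
  exact h18'

/-- **THE SAME AT THE REGIME ∕ TUPLE HOME** `RRec₁₂On 𝔯_W1 Rg` (any `Rg`). [folklore] -/
theorem s_N22_rRec₁₂On_w1_gen_of_s_N18_schemasBelow (𝔇 : AssignmentInputs₁₂ N) (Rg : (F : T4Family) → Stage12Params F N → Prop)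
    (h𝔇 : ∀ (F : T4Family) (θ : Stage12Params F N), 𝔇.w1 F θ =
      ReadingData.ofRecordAdm F θ.τ9.M N (runTowers fun k => toClusterTower (G F θ k)) (sp F θ) (gauge F θ) (hg F θ) (T₀ F θ) (hT₀ F θ) (li F θ))
    (h18 : S_N18 (RRec₁₂On (RateReading₁₂.ofAssignment (assignment₁₂ 𝔇) ne1) Rg))
    (hsch : ∀ (F : T4Family) (θ : Stage12Params F N), θ.Provisos₁₂ F N → Rg F θ → θ.Admissible F N → ∀ (k : ℕ),
      ∃ (Dk : Set ℂ) (Adm : (m : ℕ) → Set (OlderTerms (F.P k) (MatA N) θ.τ9.M m)),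
        IsOpen Dk ∧ (∀ z ∈ Dk, conj z ∈ Dk) ∧ (∀ t ∈ Ioc (0 : ℝ) θ.γ, closedBall (t : ℂ) (li F θ).r ⊆ Dk) ∧
        (∀ g : ℕ → ℂ, (∀ n, g n ∈ Dk) → ∀ m < k, olderOf (recTerm (G F θ k) g) m ∈ Adm m) ∧
        (∀ m < k, (G F θ k m).AnalyticInLast Dk (Adm m) (sp F θ k (m + 1))) ∧
        (∀ m < k, (G F θ k m).PropagatesAnalyticity Dk (Adm m) (fun j : Fin (m + 1) => sp F θ k j) (sp F θ k (m + 1))) ∧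
        (∀ g ∈ Window θ.γ, ∀ (i j : ℕ), i < j → j ≤ k → ∀ (X : (domSys (F.P k) θ.τ9.M j).Dom), ∀ φ ∈ sp F θ k j X, ∀ z ∈ Dk,
          ‖recTerm (G F θ k) (Function.update (fun n => ((g n : ℝ) : ℂ)) i z) j X φ‖ ≤
            (li F θ).A * (li F θ).μ ^ (j - 1 - i) * Real.exp (-((li F θ).κ * (domSys (F.P k) θ.τ9.M j).dj X))))
    (hnum : ∀ (F : T4Family) (θ : Stage12Params F N), θ.Provisos₁₂ F N → Rg F θ → θ.Admissible F N →
      0 < (li F θ).C₀ ∧ 0 < (li F θ).θ₅ ∧ (li F θ).θ₅ < 1 ∧ 0 ≤ (li F θ).C₅ ∧ 2 * (li F θ).C₅ / (1 - (li F θ).θ₅) ≤ (li F θ).C₀ ∧ 0 < (li F θ).A ∧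
        (li F θ).θ₅ ≤ (li F θ).μ ∧ (li F θ).C₀ ≤ 2 * (li F θ).A ∧ 0 < (li F θ).r ∧ 0 < (li F θ).s ∧ (li F θ).s < 1) :
    S_N22 (RRec₁₂On (RateReading₁₂.ofAssignment (assignment₁₂ 𝔇) ne1) Rg) := by
  rw [s_N22_rRec₁₂On_iff]
  rw [s_N18_rRec₁₂On_iff] at h18
  intro F θ hP hRg hθ g₀ os k
  show N22At (u3OfRecord₁₂ θ ((𝔇.w1 F θ).u3Objects θ.γ) k)
  rw [h𝔇 F θ]
  refine n22At_u3OfRecord₁₂_ofRecordAdm_gen_of_n18Below_schemasBelow θ (G F θ) (sp F θ) (gauge F θ) (hg F θ) (T₀ F θ) (hT₀ F θ) (li F θ) k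
    (fun k' _ => ?_) (hsch F θ hP hRg hθ k) (hnum F θ hP hRg hθ) hθ.toStage9.gamma_pos
  have h18' : N18At (u3OfRecord₁₂ θ ((𝔇.w1 F θ).u3Objects θ.γ) k') := h18 F θ hP hRg hθ g₀ os k'
  rw [h𝔇 F θ] at h18'
  exact h18'

/-- **THE SAME AT THE READING OF RECORD, EDITION 1, CANONICAL HOME** (`h𝔇 := rfl`). [folklore] -/
theorem s_N22_readingOfRecord₁₂_gen_of_s_N18_schemasBelow (ℓ₃ : T4Family → NE3Letters₁₁)
    (ne2 : (F : T4Family) → Stage12Params F N → (ℕ → ℝ) → List (ULoop F) → ℕ → NE2Objects₁₁)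
    (h18 : S_N18 (RRec₁₂ (readingOfRecord₁₂ (fun F θ =>
      ReadingData.ofRecordAdm F θ.τ9.M N (runTowers fun k => toClusterTower (G F θ k)) (sp F θ) (gauge F θ) (hg F θ) (T₀ F θ) (hT₀ F θ) (li F θ))
      ℓ₃ ne2 ne1)))
    (hsch : ∀ (F : T4Family) (θ : Stage12Params F N), θ.Provisos₁₂ F N → θ.Admissible F N → ∀ (k : ℕ),
      ∃ (Dk : Set ℂ) (Adm : (m : ℕ) → Set (OlderTerms (F.P k) (MatA N) θ.τ9.M m)),
        IsOpen Dk ∧ (∀ z ∈ Dk, conj z ∈ Dk) ∧ (∀ t ∈ Ioc (0 : ℝ) θ.γ, closedBall (t : ℂ) (li F θ).r ⊆ Dk) ∧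
        (∀ g : ℕ → ℂ, (∀ n, g n ∈ Dk) → ∀ m < k, olderOf (recTerm (G F θ k) g) m ∈ Adm m) ∧
        (∀ m < k, (G F θ k m).AnalyticInLast Dk (Adm m) (sp F θ k (m + 1))) ∧
        (∀ m < k, (G F θ k m).PropagatesAnalyticity Dk (Adm m) (fun j : Fin (m + 1) => sp F θ k j) (sp F θ k (m + 1))) ∧
        (∀ g ∈ Window θ.γ, ∀ (i j : ℕ), i < j → j ≤ k → ∀ (X : (domSys (F.P k) θ.τ9.M j).Dom), ∀ φ ∈ sp F θ k j X, ∀ z ∈ Dk,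
          ‖recTerm (G F θ k) (Function.update (fun n => ((g n : ℝ) : ℂ)) i z) j X φ‖ ≤
            (li F θ).A * (li F θ).μ ^ (j - 1 - i) * Real.exp (-((li F θ).κ * (domSys (F.P k) θ.τ9.M j).dj X))))
    (hnum : ∀ (F : T4Family) (θ : Stage12Params F N), θ.Provisos₁₂ F N → θ.Admissible F N →
      0 < (li F θ).C₀ ∧ 0 < (li F θ).θ₅ ∧ (li F θ).θ₅ < 1 ∧ 0 ≤ (li F θ).C₅ ∧ 2 * (li F θ).C₅ / (1 - (li F θ).θ₅) ≤ (li F θ).C₀ ∧ 0 < (li F θ).A ∧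
        (li F θ).θ₅ ≤ (li F θ).μ ∧ (li F θ).C₀ ≤ 2 * (li F θ).A ∧ 0 < (li F θ).r ∧ 0 < (li F θ).s ∧ (li F θ).s < 1) :
    S_N22 (RRec₁₂ (readingOfRecord₁₂ (fun F θ =>
      ReadingData.ofRecordAdm F θ.τ9.M N (runTowers fun k => toClusterTower (G F θ k)) (sp F θ) (gauge F θ) (hg F θ) (T₀ F θ) (hT₀ F θ) (li F θ))
      ℓ₃ ne2 ne1)) :=
  s_N22_rRec₁₂_w1_gen_of_s_N18_schemasBelow G sp gauge hg T₀ hT₀ li ne1 (pinnedInputs₁₂ _ ℓ₃ ne2) (fun _ _ => rfl) h18 hsch hnum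

/-- **THE SAME AT THE READING OF RECORD, EDITION 1, REGIME ∕ TUPLE HOME** (any `Rg`; `h𝔇 := rfl`). [folklore] -/
theorem s_N22_readingOfRecord₁₂On_gen_of_s_N18_schemasBelow (ℓ₃ : T4Family → NE3Letters₁₁)
    (ne2 : (F : T4Family) → Stage12Params F N → (ℕ → ℝ) → List (ULoop F) → ℕ → NE2Objects₁₁) (Rg : (F : T4Family) → Stage12Params F N → Prop)
    (h18 : S_N18 (RRec₁₂On (readingOfRecord₁₂ (fun F θ =>
      ReadingData.ofRecordAdm F θ.τ9.M N (runTowers fun k => toClusterTower (G F θ k)) (sp F θ) (gauge F θ) (hg F θ) (T₀ F θ) (hT₀ F θ) (li F θ))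
      ℓ₃ ne2 ne1) Rg))
    (hsch : ∀ (F : T4Family) (θ : Stage12Params F N), θ.Provisos₁₂ F N → Rg F θ → θ.Admissible F N → ∀ (k : ℕ),
      ∃ (Dk : Set ℂ) (Adm : (m : ℕ) → Set (OlderTerms (F.P k) (MatA N) θ.τ9.M m)),
        IsOpen Dk ∧ (∀ z ∈ Dk, conj z ∈ Dk) ∧ (∀ t ∈ Ioc (0 : ℝ) θ.γ, closedBall (t : ℂ) (li F θ).r ⊆ Dk) ∧
        (∀ g : ℕ → ℂ, (∀ n, g n ∈ Dk) → ∀ m < k, olderOf (recTerm (G F θ k) g) m ∈ Adm m) ∧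
        (∀ m < k, (G F θ k m).AnalyticInLast Dk (Adm m) (sp F θ k (m + 1))) ∧
        (∀ m < k, (G F θ k m).PropagatesAnalyticity Dk (Adm m) (fun j : Fin (m + 1) => sp F θ k j) (sp F θ k (m + 1))) ∧
        (∀ g ∈ Window θ.γ, ∀ (i j : ℕ), i < j → j ≤ k → ∀ (X : (domSys (F.P k) θ.τ9.M j).Dom), ∀ φ ∈ sp F θ k j X, ∀ z ∈ Dk,
          ‖recTerm (G F θ k) (Function.update (fun n => ((g n : ℝ) : ℂ)) i z) j X φ‖ ≤
            (li F θ).A * (li F θ).μ ^ (j - 1 - i) * Real.exp (-((li F θ).κ * (domSys (F.P k) θ.τ9.M j).dj X))))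
    (hnum : ∀ (F : T4Family) (θ : Stage12Params F N), θ.Provisos₁₂ F N → Rg F θ → θ.Admissible F N →
      0 < (li F θ).C₀ ∧ 0 < (li F θ).θ₅ ∧ (li F θ).θ₅ < 1 ∧ 0 ≤ (li F θ).C₅ ∧ 2 * (li F θ).C₅ / (1 - (li F θ).θ₅) ≤ (li F θ).C₀ ∧ 0 < (li F θ).A ∧
        (li F θ).θ₅ ≤ (li F θ).μ ∧ (li F θ).C₀ ≤ 2 * (li F θ).A ∧ 0 < (li F θ).r ∧ 0 < (li F θ).s ∧ (li F θ).s < 1) :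
    S_N22 (RRec₁₂On (readingOfRecord₁₂ (fun F θ =>
      ReadingData.ofRecordAdm F θ.τ9.M N (runTowers fun k => toClusterTower (G F θ k)) (sp F θ) (gauge F θ) (hg F θ) (T₀ F θ) (hT₀ F θ) (li F θ))
      ℓ₃ ne2 ne1) Rg) :=
  s_N22_rRec₁₂On_w1_gen_of_s_N18_schemasBelow G sp gauge hg T₀ hT₀ li ne1 (pinnedInputs₁₂ _ ℓ₃ ne2) Rg (fun _ _ => rfl) h18 hsch hnum

end Stub

/-! ## §4 At node00-def-W1's GENERATED tables `spGen` (reading `ReadingData.ofRecordGen`: the transport clause `hT₀` is W1's theorem `hT₀_spGen`) -/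

section Gen

variable {F : T4Family} (θ : Stage12Params F N) (G : (k : ℕ) → GenTower (F.P k) (MatA N) θ.τ9.M)
  (Pplus : (k : ℕ) → GaugeField (F.P k) 0 (Node00.SU N) → Prop)
  (T₀ : (k : ℕ) → GaugeField (F.P (k + 1)) 0 (Node00.SU N) → GaugeField (F.P k) 0 (Node00.SU N))
  (gauge : (k : ℕ) → GaugeField (F.P k) 0 (Node00.SU N) → GaugeField (F.P k) 0 (Node00.SU N) → ℝ) (hg : ∀ k U U', 0 ≤ gauge k U U')
  (li : LetterInputs) (k : ℕ)

/-- **N18 BELOW `k` ⇒ N22 AT `k` AT W1's GENERATED READING `ReadingData.ofRecordGen` ON THE GENERATED RUN TOWERS** — every slot object NAMED but the generator `G`, the strict class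
`Pplus`, the transport `T₀`, the gauge and the letters: §3's θ-form at `sp := spGen F θ.τ9.M N Pplus T₀`, `hT₀ := hT₀_spGen …` (`ReadingData.ofRecordGen_eq`, `rfl`); the sharp
schema package is read at the generated tables (`φ ∈ spGen … k j X` iff `φ = (ιU, 0)` with `AvGen Pplus T₀ k U`, W1's `mem_spGen_iff`). [folklore] -/
theorem n22At_u3OfRecord₁₂_ofRecordGen_gen_of_n18Below_schemasBelow
    (h18 : ∀ k' : ℕ, k' < k → N18At (u3OfRecord₁₂ θ
      ((ReadingData.ofRecordGen F θ.τ9.M N Pplus T₀ (runTowers fun k => toClusterTower (G k)) gauge hg li).u3Objects θ.γ) k'))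
    (hsch : ∃ (Dk : Set ℂ) (Adm : (m : ℕ) → Set (OlderTerms (F.P k) (MatA N) θ.τ9.M m)),
      IsOpen Dk ∧ (∀ z ∈ Dk, conj z ∈ Dk) ∧ (∀ t ∈ Ioc (0 : ℝ) θ.γ, closedBall (t : ℂ) li.r ⊆ Dk) ∧
      (∀ g : ℕ → ℂ, (∀ n, g n ∈ Dk) → ∀ m < k, olderOf (recTerm (G k) g) m ∈ Adm m) ∧
      (∀ m < k, (G k m).AnalyticInLast Dk (Adm m) (spGen F θ.τ9.M N Pplus T₀ k (m + 1))) ∧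
      (∀ m < k, (G k m).PropagatesAnalyticity Dk (Adm m) (fun j : Fin (m + 1) => spGen F θ.τ9.M N Pplus T₀ k j) (spGen F θ.τ9.M N Pplus T₀ k (m + 1))) ∧
      (∀ g ∈ Window θ.γ, ∀ (i j : ℕ), i < j → j ≤ k → ∀ (X : (domSys (F.P k) θ.τ9.M j).Dom), ∀ φ ∈ spGen F θ.τ9.M N Pplus T₀ k j X, ∀ z ∈ Dk,
        ‖recTerm (G k) (Function.update (fun n => ((g n : ℝ) : ℂ)) i z) j X φ‖ ≤
          li.A * li.μ ^ (j - 1 - i) * Real.exp (-(li.κ * (domSys (F.P k) θ.τ9.M j).dj X))))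
    (hnum : 0 < li.C₀ ∧ 0 < li.θ₅ ∧ li.θ₅ < 1 ∧ 0 ≤ li.C₅ ∧ 2 * li.C₅ / (1 - li.θ₅) ≤ li.C₀ ∧ 0 < li.A ∧ li.θ₅ ≤ li.μ ∧
      li.C₀ ≤ 2 * li.A ∧ 0 < li.r ∧ 0 < li.s ∧ li.s < 1)
    (hγ : 0 < θ.γ) :
    N22At (u3OfRecord₁₂ θ
      ((ReadingData.ofRecordGen F θ.τ9.M N Pplus T₀ (runTowers fun k => toClusterTower (G k)) gauge hg li).u3Objects θ.γ) k) :=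
  n22At_u3OfRecord₁₂_ofRecordAdm_gen_of_n18Below_schemasBelow θ G (spGen F θ.τ9.M N Pplus T₀) gauge hg T₀ (hT₀_spGen F θ.τ9.M N Pplus T₀) li k
    h18 hsch hnum hγ

end Gen

section GenStub

variable (G : (F : T4Family) → (θ : Stage12Params F N) → (k : ℕ) → GenTower (F.P k) (MatA N) θ.τ9.M)
  (Pplus : (F : T4Family) → (θ : Stage12Params F N) → (k : ℕ) → GaugeField (F.P k) 0 (Node00.SU N) → Prop)
  (T₀ : (F : T4Family) → (θ : Stage12Params F N) → (k : ℕ) → GaugeField (F.P (k + 1)) 0 (Node00.SU N) → GaugeField (F.P k) 0 (Node00.SU N))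
  (gauge : (F : T4Family) → (θ : Stage12Params F N) → (k : ℕ) → GaugeField (F.P k) 0 (Node00.SU N) → GaugeField (F.P k) 0 (Node00.SU N) → ℝ)
  (hg : ∀ (F : T4Family) (θ : Stage12Params F N) (k : ℕ) (U U' : GaugeField (F.P k) 0 (Node00.SU N)), 0 ≤ gauge F θ k U U')
  (li : (F : T4Family) → Stage12Params F N → LetterInputs) (ℓ₃ : T4Family → NE3Letters₁₁)
  (ne2 : (F : T4Family) → Stage12Params F N → (ℕ → ℝ) → List (ULoop F) → ℕ → NE2Objects₁₁)
  (ne1 : (F : T4Family) → Stage12Params F N → (ℕ → ℝ) → List (ULoop F) → NE1pCarriers)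

/-- **`S_N22` AT THE READING OF RECORD, EDITION 1, WHOSE W1 COMPONENT IS `ReadingData.ofRecordGen` ON THE GENERATED RUN TOWERS** (canonical home): `S_N18` at the same reading +
the sharp schema package at the generated tables per admissible tuple with provisos and run length + numerals ⟹ `S_N22` — §3's any-`𝔇` face with `h𝔇 := rfl`
(`ofRecordGen` IS `ofRecordAdm` at `spGen` ∕ `hT₀_spGen`).  NO transport clause, NO coherence, NO (J), NO readings clause. [folklore] -/
theorem s_N22_readingOfRecord₁₂_ofRecordGen_gen_of_s_N18_schemasBelow
    (h18 : S_N18 (RRec₁₂ (readingOfRecord₁₂ (fun F θ =>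
      ReadingData.ofRecordGen F θ.τ9.M N (Pplus F θ) (T₀ F θ) (runTowers fun k => toClusterTower (G F θ k)) (gauge F θ) (hg F θ) (li F θ)) ℓ₃ ne2 ne1)))
    (hsch : ∀ (F : T4Family) (θ : Stage12Params F N), θ.Provisos₁₂ F N → θ.Admissible F N → ∀ (k : ℕ),
      ∃ (Dk : Set ℂ) (Adm : (m : ℕ) → Set (OlderTerms (F.P k) (MatA N) θ.τ9.M m)),
        IsOpen Dk ∧ (∀ z ∈ Dk, conj z ∈ Dk) ∧ (∀ t ∈ Ioc (0 : ℝ) θ.γ, closedBall (t : ℂ) (li F θ).r ⊆ Dk) ∧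
        (∀ g : ℕ → ℂ, (∀ n, g n ∈ Dk) → ∀ m < k, olderOf (recTerm (G F θ k) g) m ∈ Adm m) ∧
        (∀ m < k, (G F θ k m).AnalyticInLast Dk (Adm m) (spGen F θ.τ9.M N (Pplus F θ) (T₀ F θ) k (m + 1))) ∧
        (∀ m < k, (G F θ k m).PropagatesAnalyticity Dk (Adm m) (fun j : Fin (m + 1) => spGen F θ.τ9.M N (Pplus F θ) (T₀ F θ) k j)
          (spGen F θ.τ9.M N (Pplus F θ) (T₀ F θ) k (m + 1))) ∧
        (∀ g ∈ Window θ.γ, ∀ (i j : ℕ), i < j → j ≤ k → ∀ (X : (domSys (F.P k) θ.τ9.M j).Dom), ∀ φ ∈ spGen F θ.τ9.M N (Pplus F θ) (T₀ F θ) k j X, ∀ z ∈ Dk,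
          ‖recTerm (G F θ k) (Function.update (fun n => ((g n : ℝ) : ℂ)) i z) j X φ‖ ≤
            (li F θ).A * (li F θ).μ ^ (j - 1 - i) * Real.exp (-((li F θ).κ * (domSys (F.P k) θ.τ9.M j).dj X))))
    (hnum : ∀ (F : T4Family) (θ : Stage12Params F N), θ.Provisos₁₂ F N → θ.Admissible F N →
      0 < (li F θ).C₀ ∧ 0 < (li F θ).θ₅ ∧ (li F θ).θ₅ < 1 ∧ 0 ≤ (li F θ).C₅ ∧ 2 * (li F θ).C₅ / (1 - (li F θ).θ₅) ≤ (li F θ).C₀ ∧ 0 < (li F θ).A ∧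
        (li F θ).θ₅ ≤ (li F θ).μ ∧ (li F θ).C₀ ≤ 2 * (li F θ).A ∧ 0 < (li F θ).r ∧ 0 < (li F θ).s ∧ (li F θ).s < 1) :
    S_N22 (RRec₁₂ (readingOfRecord₁₂ (fun F θ =>
      ReadingData.ofRecordGen F θ.τ9.M N (Pplus F θ) (T₀ F θ) (runTowers fun k => toClusterTower (G F θ k)) (gauge F θ) (hg F θ) (li F θ)) ℓ₃ ne2 ne1)) :=
  s_N22_rRec₁₂_w1_gen_of_s_N18_schemasBelow G (fun F θ => spGen F θ.τ9.M N (Pplus F θ) (T₀ F θ)) gauge hg T₀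
    (fun F θ => hT₀_spGen F θ.τ9.M N (Pplus F θ) (T₀ F θ)) li ne1 (pinnedInputs₁₂ _ ℓ₃ ne2) (fun _ _ => rfl) h18 hsch hnum

end GenStub

end YMDAG.N22

end
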